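import Literature.AlgebraicGeometry.AbelianSchemes.AbelianSchemeQuotientBaseChangeAction   -- ★ `translationActionOverWhiskerRight`, `isGeometricQuotient_translationActionOverWhiskerRight`
import Literature.AlgebraicGeometry.AbelianSchemes.TorsionSectionTranslationAction       -- ★ `translation_sectionBaseChange` (+ ★ `sectionBaseChange`, `baseChangeHom`)
import Literature.AlgebraicGeometry.AbelianSchemes.AbelianSchemeQuotientDualPairDivision   -- ★ `baseChangeHom_left_eq_whiskerRight_left'`
import Literature.AlgebraicGeometry.RelativeSpec.GeometricQuotientRecognition             -- ★ `isGeometricQuotient_overMap_iff`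
import HarnessLib

/-!
# Base change of the quotient step: `(A ×_S S′) ∕ (K ×_S S′) ≅ (A ∕ K) ×_S S′` over `S′`, compatibly with the quotient maps

Layer `Literature/AlgebraicGeometry/AbelianSchemes`, namespace `Literature.AlgebraicGeometry.AbelianSchemes.AbelianSchemeOver` (+ one lemma in
`Literature.AlgebraicGeometry.RelativeSpec.ActionOver.IsGeometricQuotient`).  THEOREMS ONLY (no definition, no instance, no notation, no named
fact, no `sorry`).  Cell `hodgecm-mathlib` (D-0151), programme P6 «MOD», P6a desk (g1) ORGAN DEALS #1 (O-α) «HECKE–SERRE CONSTRUCTOR» —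
FILE α3 «BASE CHANGE OF THE QUOTIENT STEP» (A-p14 (g32) lead, cut 18:12:47Z∕18:16:37Z; A-p17 (g25) second hand).  Inputs ★
`AbelianSchemeConstSubgroupQuotient` (`quotientOver`, `quotientMk`, `quotientActionOver`, `isGeometricQuotient_quotientActionOver`,
`isSeparated_quotientOver_left∕_hom`), ★ `AbelianSchemeQuotientBaseChangeAction` (`translationActionOverWhiskerRight`,
`isGeometricQuotient_translationActionOverWhiskerRight`: «free quotients commute with every base change»), ★ `AbelianSchemeOverLevelBaseChange`
(`sectionBaseChange`), ★ `TorsionSectionTranslationAction` (`translation_sectionBaseChange`), ★ `AbelianSchemeQuotientDualPairDivision`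
(`baseChangeHom_left_eq_whiskerRight_left'`), ★ `RelativeSpec/GeometricQuotient(Recognition)` (`IsGeometricQuotient.uniqueUpToIso`, `desc_unique`).
HC_CM is proved only modulo the printed citations until rung 0 closes; nothing here is about HC.

THE PRINT.  [MumfordAV1970] §7 Thm. p. 66 «the pair `(Y, π)` is determined up to an isomorphism» and Thm. 4 p. 72 (quotient of an abelian variety by a
finite group of translations); [SGA1] Exp. V §1 Prop. 1.9 (formation of `X∕G` commutes with flat base change; for FREE actions with every base
change); [GortzWedhorn2020] Section (4.7) (base change).

* §1 (generic, ns `…RelativeSpec.ActionOver.IsGeometricQuotient`) **`of_surjective_of_aut_eq`** — «`p` is a geometric quotient» transports along a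
  SURJECTIVE homomorphism of acting groups with the same automorphisms (Mumford՚s (1), (2) see only `X`, `p` and the SET of automorphisms).
* §2 **`translationActionOver_baseChange_aut_hom ∕ _aut_eq`** — for `σ ∈ K ⊆ A(S)` the translation of `A_{S′}` by the pulled-back section
  `σ ×_S S′` IS `t_σ × 1` (`= (t_σ ▷ S′).left`), i.e. the translation action of `K ×_S S′ := K.map (sectionBaseChange g)` on `A ×_S S′` has the
  automorphisms of ★ `translationActionOverWhiskerRight`.
* §3 `isGeometricQuotient_quotientActionOver_baseChange_whiskerRight` — `ψ × 1 : A ×_S S′ → (A∕K) ×_S S′` is a geometric quotient for THAT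
  action (★ + §1 + §2); `pullback_map_quotientMk_left` (`((Over.pullback g).map ψ).left = (ψ ▷ S′).left`); HEAD
  **`exists_iso_quotientOver_baseChange : ∃ e : (A_{S′}).quotientOver u′ (K ×_S S′) ≅ (Over.pullback g).obj (A.quotientOver u K),
  ψ′ ≫ e.hom = (Over.pullback g).map ψ`** — BOTH `ψ′` and `ψ × 1` are geometric quotients of `A ×_S S′` by the same action, so Mumford՚s
  uniqueness gives the isomorphism of schemes, and `desc_unique` makes it an `S′`-isomorphism.

BINDERS are ★ `quotientOver`∕`quotientMk`՚s VERBATIM on both sides: `A` over `u : S ⟶ Y` (`[Finite K] [Y.IsSeparated] [IsSeparated (A.X.hom ≫ u)]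
[S.IsSeparated] [IsAffine Y] hcov hfree`) and `A.baseChange g` over `u′ : S′ ⟶ Y′` (`[Finite (K.map (A.sectionBaseChange g))] [Y′.IsSeparated]
[IsSeparated ((A.baseChange g).X.hom ≫ u′)] [S′.IsSeparated] [IsAffine Y′] hcov′`); no `hG∕hsm∕hgc` (the statement is about the carriers
`quotientOver`∕`quotientMk` of ★ `quotientBy`).  NOT HERE: `IsMonHom e.hom` for the two `quotientBy` group laws (α3b if ED. 4 asks).

## References
* [MumfordAV1970] D. Mumford, *Abelian Varieties* (1970), §7 Thm. p. 66 (uniqueness of the geometric quotient), Thm. 4 (p. 72).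
* [SGA1] A. Grothendieck, *SGA 1*, Exp. V §1, Prop. 1.9 (quotients and base change).
* [GortzWedhorn2020] U. Görtz, T. Wedhorn, *Algebraic Geometry I*, 2nd ed. (2020), Section (4.7) (pp. 107–108).
-/

set_option autoImplicit false

noncomputable section

universe u

open CategoryTheory CategoryTheory.Limits AlgebraicGeometry MonoidalCategory CartesianMonoidalCategory
open scoped MonObj

/-! ## §1 Geometric quotients see only the SET of automorphisms: transport along a surjective group homomorphism -/

namespace Literature.AlgebraicGeometry.RelativeSpec.ActionOver.IsGeometricQuotient

variable {X Y Y' : Scheme.{u}} {r : X ⟶ Y} {r' : X ⟶ Y'} {G G' : Type*} [Group G] [Group G']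
  {ρ : ActionOver r G} {ρ' : ActionOver r' G'}

/-- **Transport of «`p` is a geometric quotient» along a SURJECTIVE homomorphism of acting groups with the same automorphisms**:
if `φ : G → G′` is onto and `ρ′(φ g) = ρ(g)` for all `g`, then a geometric quotient for `ρ` is one for `ρ′` (Mumford's conditions (1),
(2) mention only `X`, `p` and the set of automorphisms). [cite: MumfordAV1970, §7 Thm. p. 66 (1), (2)] -/
theorem of_surjective_of_aut_eq (φ : G →* G') (hφ : Function.Surjective φ) (haut : ∀ g : G, ρ'.aut (φ g) = ρ.aut g)
    {Q : Scheme.{u}} {p : X ⟶ Q} (h : ρ.IsGeometricQuotient p) : ρ'.IsGeometricQuotient p := by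
  have key : ∀ (a b : Aut X) (hab : a = b) (W : Q.Opens) (s : Γ(X, p ⁻¹ᵁ W)) (e : p ⁻¹ᵁ W ≤ a.hom ⁻¹ᵁ (p ⁻¹ᵁ W)),
      a.hom.appLE (p ⁻¹ᵁ W) (p ⁻¹ᵁ W) e s = b.hom.appLE (p ⁻¹ᵁ W) (p ⁻¹ᵁ W) (hab ▸ e) s := by
    intro a b hab W s e
    subst hab
    rfl
  refine ⟨?_, h.surjective, h.isOpenMap, ?_, h.quasiCompact, h.ker_eq_bot, ?_⟩
  · intro g'
    obtain ⟨g, rfl⟩ := hφ g'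
    rw [haut]
    exact h.comp_eq g
  · intro x₁ x₂ hx
    obtain ⟨g, hg⟩ := h.exists_aut_apply_eq hx
    exact ⟨φ g, by rw [haut]; exact hg⟩
  · intro W s hs
    refine h.exists_app_eq W s fun g e => ?_
    have hg : ρ.aut g⁻¹ = ρ'.aut (φ g)⁻¹ := by rw [← map_inv, haut]
    rw [key _ _ hg W s e]
    exact hs (φ g) _

end Literature.AlgebraicGeometry.RelativeSpec.ActionOver.IsGeometricQuotient

/-! ## §2 The translation action of the base-changed sections on `A ×_S S′` is `t_• × 1` -/

namespace Literature.AlgebraicGeometry.AbelianSchemes.AbelianSchemeOver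

open Literature.AlgebraicGeometry.RelativeSpec

variable {S : Scheme.{u}} (A : AbelianSchemeOver S) {Y : Scheme.{u}} (u : S ⟶ Y) (K : Subgroup A.Sections)
  {S' : Scheme.{u}} (g : S' ⟶ S) {Y' : Scheme.{u}} (u' : S' ⟶ Y')

/-- **Base-changed translations are `t_σ × 1`**: for `σ ∈ K`, the automorphism of `A ×_S S′ = (A_{S′}).left` by which the
pulled-back section `σ ×_S S′ ∈ K ×_S S′ := K.map (sectionBaseChange g)` acts (the translation action of `A_{S′}`) is the
whiskering `(t_σ ▷ S′).left` (★ `translation_sectionBaseChange`, ★ `baseChangeHom_left_eq_whiskerRight_left'`).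
[cite: MumfordAV1970, §7 Thm. 4 (p. 72)] [cite: GortzWedhorn2020, Section (4.7) (pp. 107–108)] -/
theorem translationActionOver_baseChange_aut_hom (σ : K) :
    (((A.baseChange g).translationActionOver u' (K.map (A.sectionBaseChange g))).aut
        ((A.sectionBaseChange g).subgroupMap K σ)).hom = (A.translation (σ : A.Sections) ▷ Over.mk g).left := by
  rw [translationActionOver_aut_hom]
  change ((A.baseChange g).translation (A.sectionBaseChange g (σ : A.Sections))).left = _
  rw [translation_sectionBaseChange]
  exact A.baseChangeHom_left_eq_whiskerRight_left' A (Over.mk g) (A.translation (σ : A.Sections))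

variable [Finite K] [Y.IsSeparated] [IsSeparated (A.X.hom ≫ u)] [S.IsSeparated]
  (hcov : ∀ x : A.left, ∃ O : (A.translationActionOver u K).StableAffineOpens, x ∈ O.1)

/-- The same, against the automorphisms of ★ `translationActionOverWhiskerRight A (Over.mk g) u K hcov` (which ARE `t_σ ▷ S′`).
[cite: MumfordAV1970, §7 Thm. 4 (p. 72)] -/
theorem translationActionOver_baseChange_aut_eq (σ : K) :
    ((A.baseChange g).translationActionOver u' (K.map (A.sectionBaseChange g))).aut ((A.sectionBaseChange g).subgroupMap K σ) =
      (translationActionOverWhiskerRight A (Over.mk g) u K hcov).aut σ := by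
  ext1
  rw [translationActionOver_baseChange_aut_hom, translationActionOverWhiskerRight_aut_hom]

/-! ## §3 `(A ×_S S′)∕(K ×_S S′) ≅ (A∕K) ×_S S′` over `S′`, compatibly with the quotient maps -/

variable [IsAffine Y]
  [Finite (K.map (A.sectionBaseChange g))] [Y'.IsSeparated] [IsSeparated ((A.baseChange g).X.hom ≫ u')] [S'.IsSeparated] [IsAffine Y']
  (hcov' : ∀ x : (A.baseChange g).left,
    ∃ O : ((A.baseChange g).translationActionOver u' (K.map (A.sectionBaseChange g))).StableAffineOpens, x ∈ O.1)

omit [IsAffine Y'] in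
/-- **`ψ × 1 : A ×_S S′ → (A∕K) ×_S S′` is a geometric quotient for the translation action of the base-changed sections `K ×_S S′`
on `A_{S′}`** (★ `isGeometricQuotient_translationActionOverWhiskerRight` — free quotients commute with base change — transported along
`K ↠ K ×_S S′` by §1–§2). [cite: MumfordAV1970, §7 Thm. 4 (p. 72)] [cite: SGA1, Exp. V §1, Prop. 1.9] -/
theorem isGeometricQuotient_quotientActionOver_baseChange_whiskerRight
    (hfree : ∀ (Ω : Type u) [Field Ω] [IsAlgClosed Ω] (x : Spec (.of Ω) ⟶ A.left) (σ : K), σ ≠ 1 →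
      x ≫ (A.translation (σ : A.Sections)).left ≠ x) :
    ((A.baseChange g).quotientActionOver u' (K.map (A.sectionBaseChange g)) hcov').IsGeometricQuotient
      (A.quotientMk u K hcov ▷ Over.mk g).left := by
  have h₂ := isGeometricQuotient_translationActionOverWhiskerRight A (Over.mk g) u K hcov hfree
  have h₂' : ((A.baseChange g).translationActionOver u' (K.map (A.sectionBaseChange g))).IsGeometricQuotient
      (A.quotientMk u K hcov ▷ Over.mk g).left :=
    h₂.of_surjective_of_aut_eq ((A.sectionBaseChange g).subgroupMap K) ((A.sectionBaseChange g).subgroupMap_surjective K)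
      (fun σ => A.translationActionOver_baseChange_aut_eq u K g u' hcov σ)
  obtain ⟨h1, h2, h3, h4, h5, h6, h7⟩ := h₂'
  exact ⟨h1, h2, h3, h4, h5, h6, h7⟩

omit [IsAffine Y] [Finite (K.map (A.sectionBaseChange g))] [S'.IsSeparated] [Y'.IsSeparated]
  [IsSeparated ((A.baseChange g).X.hom ≫ u')] [IsAffine Y'] in
/-- The underlying morphism of `(Over.pullback g).map ψ` is the whiskering `(ψ ▷ S′).left` (both are `pullback.map` on `(ψ.left, 𝟙, 𝟙)`).
[cite: GortzWedhorn2020, Section (4.7) (pp. 107–108)] -/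
theorem pullback_map_quotientMk_left :
    ((Over.pullback g).map (A.quotientMk u K hcov)).left = (A.quotientMk u K hcov ▷ Over.mk g).left := by
  apply pullback.hom_ext
  · erw [Over.whiskerRight_left_fst]
    exact pullback.lift_fst _ _ _
  · erw [Over.whiskerRight_left_snd]
    exact pullback.lift_snd _ _ _

/-- **HEAD — BASE CHANGE OF THE QUOTIENT STEP: `(A ×_S S′) ∕ (K ×_S S′) ≅ (A ∕ K) ×_S S′` over `S′`, compatibly with the quotient
maps.**  Both `ψ′ : A_{S′} → A_{S′}∕(K ×_S S′)` (★ `isGeometricQuotient_quotientActionOver`) and `ψ × 1 : A_{S′} → (A∕K) ×_S S′` (§3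
`isGeometricQuotient_quotientActionOver_baseChange_whiskerRight`) are geometric quotients of `A ×_S S′` by the SAME action, so Mumford's
uniqueness (★ `IsGeometricQuotient.uniqueUpToIso`) gives the isomorphism, and ★ `desc_unique` makes it an `S′`-isomorphism — «the
formation of `A∕K` commutes with arbitrary base change» for the free quotient by a finite constant subgroup.
[cite: MumfordAV1970, §7 Thm. p. 66 and Thm. 4 (p. 72)] [cite: SGA1, Exp. V §1, Prop. 1.9] [cite: GortzWedhorn2020, Section (4.7) (pp. 107–108)] -/
theorem exists_iso_quotientOver_baseChange
    (hfree : ∀ (Ω : Type u) [Field Ω] [IsAlgClosed Ω] (x : Spec (.of Ω) ⟶ A.left) (σ : K), σ ≠ 1 →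
      x ≫ (A.translation (σ : A.Sections)).left ≠ x) :
    ∃ e : (A.baseChange g).quotientOver u' (K.map (A.sectionBaseChange g)) ≅ (Over.pullback g).obj (A.quotientOver u K),
      (A.baseChange g).quotientMk u' (K.map (A.sectionBaseChange g)) hcov' ≫ e.hom = (Over.pullback g).map (A.quotientMk u K hcov) := by
  have h₁ := (A.baseChange g).isGeometricQuotient_quotientActionOver u' (K.map (A.sectionBaseChange g)) hcov'
  have h₂ := A.isGeometricQuotient_quotientActionOver_baseChange_whiskerRight u K g u' hcov hcov' hfree
  haveI : ((A.baseChange g).quotientOver u' (K.map (A.sectionBaseChange g))).left.IsSeparated :=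
    (A.baseChange g).isSeparated_quotientOver_left u' (K.map (A.sectionBaseChange g)) hcov'
  haveI : (A.quotientOver u K).left.IsSeparated := A.isSeparated_quotientOver_left u K hcov
  haveI : IsSeparated (A.quotientOver u K).hom := A.isSeparated_quotientOver_hom u K hcov
  haveI : IsSeparated (pullback.snd (A.quotientOver u K).hom g) := inferInstance
  haveI : IsSeparated (terminal.from S') := inferInstance
  haveI : ((A.quotientOver u K) ⊗ Over.mk g).left.IsSeparated := by
    change (pullback (A.quotientOver u K).hom g).IsSeparated
    refine ⟨?_⟩
    rw [← terminal.comp_from (pullback.snd (A.quotientOver u K).hom g)]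
    infer_instance
  -- Mumford's uniqueness of the geometric quotient (an isomorphism of the underlying schemes)
  let e₀ : ((A.baseChange g).quotientOver u' (K.map (A.sectionBaseChange g))).left ≅
      ((Over.pullback g).obj (A.quotientOver u K)).left :=
    show ((A.baseChange g).quotientOver u' (K.map (A.sectionBaseChange g))).left ≅ ((A.quotientOver u K) ⊗ Over.mk g).left from
      h₁.uniqueUpToIso h₂
  have he₀ : ((A.baseChange g).quotientMk u' (K.map (A.sectionBaseChange g)) hcov').left ≫ e₀.hom =
      (A.quotientMk u K hcov ▷ Over.mk g).left :=
    h₁.comp_uniqueUpToIso_hom h₂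
  -- `e₀` is over `S′`: both composites with `ψ′` are the structure map `A ×_S S′ → S′`
  have hw : e₀.hom ≫ ((Over.pullback g).obj (A.quotientOver u K)).hom =
      ((A.baseChange g).quotientOver u' (K.map (A.sectionBaseChange g))).hom := by
    apply h₁.desc_unique
    rw [← Category.assoc, he₀]
    exact (Over.whiskerRight_left_snd (A.quotientMk u K hcov)).trans
      (Over.w ((A.baseChange g).quotientMk u' (K.map (A.sectionBaseChange g)) hcov')).symm
  refine ⟨Over.isoMk e₀ hw, ?_⟩
  ext1
  change ((A.baseChange g).quotientMk u' (K.map (A.sectionBaseChange g)) hcov').left ≫ e₀.hom =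
    ((Over.pullback g).map (A.quotientMk u K hcov)).left
  exact he₀.trans (A.pullback_map_quotientMk_left u K g hcov).symm

end Literature.AlgebraicGeometry.AbelianSchemes.AbelianSchemeOver

end
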